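import Summits.ResolutionOfSingularities.ResolutionOfSingularities.Theses.Valuative
import Literature.AlgebraicGeometry.Resolution.ResolutionOfComponents

/-!
# `PatchingRel` (stmt-ResolutionOfSingularities-0642) splits by dimension: the integral
# dimension-`≤ 4` slice and the integral dimension-`≥ 5` slice

Crux-strategist decomposition (unit `cstrat-stmt-ResolutionOfSingularities-0642-p1`, 2026-08-17).
The crux `PatchingRel : ∀ p prime, LUrel_p → ResolutionInChar p` is, by
`resolutionInChar_iff_integral`, resolution of INTEGRAL separated schemes of finite type over
fields of characteristic `p` from relative local uniformization; an integral scheme of finite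
type has `topologicalKrullDim ≤ 4` or not. Hence the crux follows from its two dimension slices

* `PatchingRelDimLeFour`  — `∀ p prime, LUrel_p → (integral X/k, char k = p, dim X ≤ 4 ⇒ HasResolution X)`,
* `PatchingRelDimGeFive` — the same for integral `X` with `¬ dim X ≤ 4`,

by a case split (`patchingRel_of_dimLeFour_of_dimGeFive`, the glue of the route split). Integrality
is what keeps the second slice honest: for merely reduced `X` the slice `¬ dim X ≤ 4` would contain
`X₄ ⊔ 𝔸⁵` and hence the first slice. The statements of the two slices are written out verbatim
(they become the route decls `Valuative.PatchingRelDimLeFour/DimGeFive`; this theorem's type is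
their unfolding). See `Cruxes/PatchingRel/STRATEGY-CENSUS.md` for why the crux admits no
non-degenerate all-dimensional line and why dimension `4` is where the recorded ideas
(`successive-centres`, `closed-point-fibre-freedom`, fibre-confined principalization) become
admissible.
-/

namespace Summit.ResolutionOfSingularities.ResolutionOfSingularities.Theorems

open Literature.AlgebraicGeometry.Resolution
open CategoryTheory AlgebraicGeometry

/-- **Dimension split of `PatchingRel`.** Relative local uniformization in characteristic `p`
implies resolution in characteristic `p` as soon as it implies resolution of INTEGRAL separated
schemes of finite type of dimension `≤ 4` and of dimension `≥ 5` (i.e. `¬ ≤ 4`) separately: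
reduce `ResolutionInChar p` to the integral case (`resolutionInChar_iff_integral`: resolve the
irreducible components and glue, Cossart–Piltant 2019 proof of Prop. 4.6 Step 1) and split on
`topologicalKrullDim X ≤ 4`. [cite: CossartPiltant2019, proof of Prop. 4.6, Step 1 (arXiv v1:
Prop. 4.4)] -/
theorem patchingRel_of_dimLeFour_of_dimGeFive
    (h4 : ∀ p : ℕ, p.Prime → (∀ (k K : Type) [Field k] [CharP k p] [Field K] [Algebra k K], (⊤ : IntermediateField k K).FG → ∀ O : ValuationSubring K, (∀ c : k, algebraMap k K c ∈ O) → ∀ R : Subalgebra k K, R.FG → R.toSubring ≤ O.toSubring → ∃ (A : Subalgebra k K) (h : A.toSubring ≤ O.toSubring), R ≤ A ∧ A.FG ∧ IsFractionRing A K ∧ IsRegularLocalRing (Localization.AtPrime (Ideal.comap (Subring.inclusion h) (IsLocalRing.maximalIdeal O)))) → ∀ (k : Type) [Field k] [CharP k p] (X : AlgebraicGeometry.Scheme.{0}) (f : X ⟶ AlgebraicGeometry.Spec (CommRingCat.of k)), AlgebraicGeometry.IsSeparated f → AlgebraicGeometry.LocallyOfFiniteType f → AlgebraicGeometry.QuasiCompact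 f → AlgebraicGeometry.IsIntegral X → topologicalKrullDim X ≤ 4 → Literature.AlgebraicGeometry.Resolution.Scheme.HasResolution X)
    (h5 : ∀ p : ℕ, p.Prime → (∀ (k K : Type) [Field k] [CharP k p] [Field K] [Algebra k K], (⊤ : IntermediateField k K).FG → ∀ O : ValuationSubring K, (∀ c : k, algebraMap k K c ∈ O) → ∀ R : Subalgebra k K, R.FG → R.toSubring ≤ O.toSubring → ∃ (A : Subalgebra k K) (h : A.toSubring ≤ O.toSubring), R ≤ A ∧ A.FG ∧ IsFractionRing A K ∧ IsRegularLocalRing (Localization.AtPrime (Ideal.comap (Subring.inclusion h) (IsLocalRing.maximalIdeal O)))) → ∀ (k : Type) [Field k] [CharP k p] (X : AlgebraicGeometry.Scheme.{0}) (f : X ⟶ AlgebraicGeometry.Spec (CommRingCat.of k)), AlgebraicGeometry.IsSeparated f → AlgebraicGeometry.LocallyOfFiniteType f → AlgebraicGeometry.QuasiCompact f → AlgebraicGeometry.IsIntegral X → ¬ topologicalKrullDim X ≤ 4 → Literature.AlgebraicGeometry.Resolution.Scheme.HasResolution X) :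
    Theses.Valuative.PatchingRel := by
  intro p hp hLU
  rw [resolutionInChar_iff_integral]
  intro k _ _ X f hsep hft hqc hint
  by_cases hd : topologicalKrullDim X ≤ 4
  · exact h4 p hp hLU k X f hsep hft hqc hint hd
  · exact h5 p hp hLU k X f hsep hft hqc hint hd

/-- The converse bookkeeping: `PatchingRel` gives back both slices (so the split loses nothing).
[folklore] -/
theorem dimLeFour_of_patchingRel (h : Theses.Valuative.PatchingRel) :
    ∀ p : ℕ, p.Prime → (∀ (k K : Type) [Field k] [CharP k p] [Field K] [Algebra k K], (⊤ : IntermediateField k K).FG → ∀ O : ValuationSubring K, (∀ c : k, algebraMap k K c ∈ O) → ∀ R : Subalgebra k K, R.FG → R.toSubring ≤ O.toSubring → ∃ (A : Subalgebra k K) (h : A.toSubring ≤ O.toSubring), R ≤ A ∧ A.FG ∧ IsFractionRing A K ∧ IsRegularLocalRing (Localization.AtPrime (Ideal.comap (Subring.inclusion h) (IsLocalRing.maximalIdeal O)))) → ∀ (k : Type) [Field k] [CharP k p] (X : AlgebraicGeometry.Scheme.{0}) (f : X ⟶ AlgebraicGeometry.Spec (CommRingCat.of k)), AlgebraicGeometry.IsSeparated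 f → AlgebraicGeometry.LocallyOfFiniteType f → AlgebraicGeometry.QuasiCompact f → AlgebraicGeometry.IsIntegral X → topologicalKrullDim X ≤ 4 → Literature.AlgebraicGeometry.Resolution.Scheme.HasResolution X := by
  intro p hp hLU k _ _ X f hsep hft hqc hint _
  exact (resolutionInChar_iff_integral p).mp (h p hp hLU) k X f hsep hft hqc hint

/-- The converse bookkeeping for the high slice. [folklore] -/
theorem dimGeFive_of_patchingRel (h : Theses.Valuative.PatchingRel) :
    ∀ p : ℕ, p.Prime → (∀ (k K : Type) [Field k] [CharP k p] [Field K] [Algebra k K], (⊤ : IntermediateField k K).FG → ∀ O : ValuationSubring K, (∀ c : k, algebraMap k K c ∈ O) → ∀ R : Subalgebra k K, R.FG → R.toSubring ≤ O.toSubring → ∃ (A : Subalgebra k K) (h : A.toSubring ≤ O.toSubring), R ≤ A ∧ A.FG ∧ IsFractionRing A K ∧ IsRegularLocalRing (Localization.AtPrime (Ideal.comap (Subring.inclusion h) (IsLocalRing.maximalIdeal O)))) → ∀ (k : Type) [Field k] [CharP k p] (X : AlgebraicGeometry.Scheme.{0}) (f : X ⟶ AlgebraicGeometry.Spec (CommRingCat.of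 k)), AlgebraicGeometry.IsSeparated f → AlgebraicGeometry.LocallyOfFiniteType f → AlgebraicGeometry.QuasiCompact f → AlgebraicGeometry.IsIntegral X → ¬ topologicalKrullDim X ≤ 4 → Literature.AlgebraicGeometry.Resolution.Scheme.HasResolution X := by
  intro p hp hLU k _ _ X f hsep hft hqc hint _
  exact (resolutionInChar_iff_integral p).mp (h p hp hLU) k X f hsep hft hqc hint

end Summit.ResolutionOfSingularities.ResolutionOfSingularities.Theorems
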